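import Literature.NumberTheory.Automorphic.StandardLTheoryGL2OfGlobalHeckeTheoryProofs
import Literature.NumberTheory.Automorphic.TwistedHeckeTheoryGL2OfStandardLTheoryGL2Proofs
import HarnessLib

/-!
# `π(σ)` at the `σ`-unramified places and the twisted Hecke theory of `GL(2)`, from the global
# Hecke theory of the canonical local Euler polynomials (Gelbart 1997, Prop. 4.1; JL 1970, §§9–12)

Topic `Literature/NumberTheory/Automorphic`; proof file (theorems only: no definition, no named
fact, no instance).  Composition of the by-name chain
`frobSatakeCompatibleAt_of_isPiOfArtinRep_of_isUnramifiedAt ⟸ JacquetLanglands1970_twistedHeckeTheoryGL2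
⟸ JacquetLanglands1970_standardLTheoryGL2` (`TwistedHeckeTheoryGL2OfStandardLTheoryGL2Proofs`)
with the reduction of the standard `L`-function theory to its global analytic clause
(`JacquetLanglands1970_standardLTheoryGL2_of_globalHeckeTheory`,
`StandardLTheoryGL2OfGlobalHeckeTheoryProofs`): the named facts
`JacquetLanglands1970_twistedHeckeTheoryGL2` (Jacquet–Langlands 1970, Thm. 11.1, Cor. 11.2,
Lemma 12.5) and `frobSatakeCompatibleAt_of_isPiOfArtinRep_of_isUnramifiedAt` (Gelbart 1997,
Prop. 4.1, the `σ`-unramified shadow) follow from the GLOBAL HECKE THEORY ALONE — Euler product,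
continuation and functional equation `Λ(s) = ε(s) Λ'(1 - s)` for the canonical local Euler
polynomials of `π` and `π^τ` (Jacquet–Langlands 1970, §§9–11) — every local and dictionary input
being proved in the tree.

## References

* S. Gelbart, *Three lectures on the modularity of ρ̄_{E,3} and the Langlands reciprocity
  conjecture* (1997), Prop. 4.1. [Gelbart1997]
* H. Jacquet, R. P. Langlands, *Automorphic Forms on GL(2)*, LNM 114 (1970), Thm. 11.1,
  Cor. 11.2, Lemma 12.5, Thm. 12.2. [JacquetLanglands1970]
-/

noncomputable section

open scoped MatrixGroups NNReal Classical NumberField Polynomial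
open MeasureTheory NumberField IsDedekindDomain Polynomial

namespace Literature.NumberTheory.Automorphic

/-- **The twisted Hecke theory of cuspidal `GL(2)` from the global Hecke theory of the canonical
local Euler polynomials** (Jacquet–Langlands 1970, Thm. 11.1, Cor. 11.2, Lemma 12.5).
[cite: JacquetLanglands1970, Thm. 11.1, Cor. 11.2, Lemma 12.5] -/
theorem JacquetLanglands1970_twistedHeckeTheoryGL2_of_globalHeckeTheory
    (hR1 : ∀ {F : Type} [Field F] [NumberField F] (hcpt : isCompact_glFiniteIntegralLevel 2 F)
      (π : CuspidalAutomorphicRepData 2 F hcpt) (P P' : HeightOneSpectrum (𝓞 F) → ℂ[X]),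
      (∀ (u : HeightOneSpectrum (𝓞 F)) (πu : SmoothIrrep (GL (Fin 2) (u.adicCompletion F))),
        π.1.HasLocalComponentAt u πu.ρ →
        ∀ (ψ : AddChar (u.adicCompletion F) Circle), ψ.IsContinuousNontrivial →
        ∀ [MeasurableSpace (u.adicCompletion F)] [BorelSpace (u.adicCompletion F)]
          [MeasurableSpace (GL (Fin 1) (u.adicCompletion F) ⧸ upperUnitriangular (Fin 1) (u.adicCompletion F))]
          [BorelSpace (GL (Fin 1) (u.adicCompletion F) ⧸ upperUnitriangular (Fin 1) (u.adicCompletion F))]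
          (ν : Measure (GL (Fin 1) (u.adicCompletion F) ⧸ upperUnitriangular (Fin 1) (u.adicCompletion F)))
          [SMulInvariantMeasure (GL (Fin 1) (u.adicCompletion F))
            (GL (Fin 1) (u.adicCompletion F) ⧸ upperUnitriangular (Fin 1) (u.adicCompletion F)) ν]
          [IsFiniteMeasureOnCompacts ν] [ν.IsOpenPosMeasure],
          HasRSLFactor Nat.one_lt_two πu.ρ
            (Representation.trivial ℂ (GL (Fin 1) (u.adicCompletion F)) ℂ) ψ ν (P u)) →
      (∀ (u : HeightOneSpectrum (𝓞 F)) (πu : SmoothIrrep (GL (Fin 2) (u.adicCompletion F))),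
        π.transposeInv.1.HasLocalComponentAt u πu.ρ →
        ∀ (ψ : AddChar (u.adicCompletion F) Circle), ψ.IsContinuousNontrivial →
        ∀ [MeasurableSpace (u.adicCompletion F)] [BorelSpace (u.adicCompletion F)]
          [MeasurableSpace (GL (Fin 1) (u.adicCompletion F) ⧸ upperUnitriangular (Fin 1) (u.adicCompletion F))]
          [BorelSpace (GL (Fin 1) (u.adicCompletion F) ⧸ upperUnitriangular (Fin 1) (u.adicCompletion F))]
          (ν : Measure (GL (Fin 1) (u.adicCompletion F) ⧸ upperUnitriangular (Fin 1) (u.adicCompletion F)))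
          [SMulInvariantMeasure (GL (Fin 1) (u.adicCompletion F))
            (GL (Fin 1) (u.adicCompletion F) ⧸ upperUnitriangular (Fin 1) (u.adicCompletion F)) ν]
          [IsFiniteMeasureOnCompacts ν] [ν.IsOpenPosMeasure],
          HasRSLFactor Nat.one_lt_two πu.ρ
            (Representation.trivial ℂ (GL (Fin 1) (u.adicCompletion F)) ℂ) ψ ν (P' u)) →
      ∃ (Λ Λ' Γ Γ' ε : ℂ → ℂ) (c : ℝ),
        Meromorphic Λ ∧ Meromorphic Λ' ∧ Differentiable ℂ Γ ∧ Differentiable ℂ Γ' ∧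
        (∃ Y : Set ℝ, Y.Finite ∧ ∀ s, Γ s = 0 → s.im ∈ Y) ∧
        (∃ Y : Set ℝ, Y.Finite ∧ ∀ s, Γ' s = 0 → s.im ∈ Y) ∧
        Continuous ε ∧ (∀ s, ε s ≠ 0) ∧ 1 ≤ c ∧
        (∀ s : ℂ, c < s.re →
          (Multipliable fun u : HeightOneSpectrum (𝓞 F) =>
              ((P u).eval ((u.residueCard : ℂ) ^ (-s)))⁻¹) ∧
            (∀ u, (P u).eval ((u.residueCard : ℂ) ^ (-s)) ≠ 0) ∧
            Λ s * Γ s =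
              ∏' u : HeightOneSpectrum (𝓞 F), ((P u).eval ((u.residueCard : ℂ) ^ (-s)))⁻¹) ∧
        (∀ s : ℂ, c < s.re →
          (Multipliable fun u : HeightOneSpectrum (𝓞 F) =>
              ((P' u).eval ((u.residueCard : ℂ) ^ (-s)))⁻¹) ∧
            (∀ u, (P' u).eval ((u.residueCard : ℂ) ^ (-s)) ≠ 0) ∧
            Λ' s * Γ' s =
              ∏' u : HeightOneSpectrum (𝓞 F), ((P' u).eval ((u.residueCard : ℂ) ^ (-s)))⁻¹) ∧
        (∀ s, Λ s = ε s * Λ' (1 - s))) :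
    JacquetLanglands1970_twistedHeckeTheoryGL2 :=
  JacquetLanglands1970_twistedHeckeTheoryGL2_of_JacquetLanglands1970_standardLTheoryGL2
    (JacquetLanglands1970_standardLTheoryGL2_of_globalHeckeTheory hR1)

/-- **`π(σ)` has Satake parameter `A(σ, v)` at every `σ`-unramified place, from the global Hecke
theory of the canonical local Euler polynomials** (Gelbart 1997, Prop. 4.1 — the `σ`-unramified
shadow; Jacquet–Langlands 1970, Thm. 12.2 with §§9–11): the named fact
`frobSatakeCompatibleAt_of_isPiOfArtinRep_of_isUnramifiedAt` modulo exactly clause (an).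
[cite: Gelbart1997, Prop. 4.1] [cite: JacquetLanglands1970, Thm. 12.2, Thm. 11.1] -/
theorem frobSatakeCompatibleAt_of_isPiOfArtinRep_of_isUnramifiedAt_of_globalHeckeTheory
    (hR1 : ∀ {F : Type} [Field F] [NumberField F] (hcpt : isCompact_glFiniteIntegralLevel 2 F)
      (π : CuspidalAutomorphicRepData 2 F hcpt) (P P' : HeightOneSpectrum (𝓞 F) → ℂ[X]),
      (∀ (u : HeightOneSpectrum (𝓞 F)) (πu : SmoothIrrep (GL (Fin 2) (u.adicCompletion F))),
        π.1.HasLocalComponentAt u πu.ρ →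
        ∀ (ψ : AddChar (u.adicCompletion F) Circle), ψ.IsContinuousNontrivial →
        ∀ [MeasurableSpace (u.adicCompletion F)] [BorelSpace (u.adicCompletion F)]
          [MeasurableSpace (GL (Fin 1) (u.adicCompletion F) ⧸ upperUnitriangular (Fin 1) (u.adicCompletion F))]
          [BorelSpace (GL (Fin 1) (u.adicCompletion F) ⧸ upperUnitriangular (Fin 1) (u.adicCompletion F))]
          (ν : Measure (GL (Fin 1) (u.adicCompletion F) ⧸ upperUnitriangular (Fin 1) (u.adicCompletion F)))
          [SMulInvariantMeasure (GL (Fin 1) (u.adicCompletion F))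
            (GL (Fin 1) (u.adicCompletion F) ⧸ upperUnitriangular (Fin 1) (u.adicCompletion F)) ν]
          [IsFiniteMeasureOnCompacts ν] [ν.IsOpenPosMeasure],
          HasRSLFactor Nat.one_lt_two πu.ρ
            (Representation.trivial ℂ (GL (Fin 1) (u.adicCompletion F)) ℂ) ψ ν (P u)) →
      (∀ (u : HeightOneSpectrum (𝓞 F)) (πu : SmoothIrrep (GL (Fin 2) (u.adicCompletion F))),
        π.transposeInv.1.HasLocalComponentAt u πu.ρ →
        ∀ (ψ : AddChar (u.adicCompletion F) Circle), ψ.IsContinuousNontrivial →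
        ∀ [MeasurableSpace (u.adicCompletion F)] [BorelSpace (u.adicCompletion F)]
          [MeasurableSpace (GL (Fin 1) (u.adicCompletion F) ⧸ upperUnitriangular (Fin 1) (u.adicCompletion F))]
          [BorelSpace (GL (Fin 1) (u.adicCompletion F) ⧸ upperUnitriangular (Fin 1) (u.adicCompletion F))]
          (ν : Measure (GL (Fin 1) (u.adicCompletion F) ⧸ upperUnitriangular (Fin 1) (u.adicCompletion F)))
          [SMulInvariantMeasure (GL (Fin 1) (u.adicCompletion F))
            (GL (Fin 1) (u.adicCompletion F) ⧸ upperUnitriangular (Fin 1) (u.adicCompletion F)) ν]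
          [IsFiniteMeasureOnCompacts ν] [ν.IsOpenPosMeasure],
          HasRSLFactor Nat.one_lt_two πu.ρ
            (Representation.trivial ℂ (GL (Fin 1) (u.adicCompletion F)) ℂ) ψ ν (P' u)) →
      ∃ (Λ Λ' Γ Γ' ε : ℂ → ℂ) (c : ℝ),
        Meromorphic Λ ∧ Meromorphic Λ' ∧ Differentiable ℂ Γ ∧ Differentiable ℂ Γ' ∧
        (∃ Y : Set ℝ, Y.Finite ∧ ∀ s, Γ s = 0 → s.im ∈ Y) ∧
        (∃ Y : Set ℝ, Y.Finite ∧ ∀ s, Γ' s = 0 → s.im ∈ Y) ∧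
        Continuous ε ∧ (∀ s, ε s ≠ 0) ∧ 1 ≤ c ∧
        (∀ s : ℂ, c < s.re →
          (Multipliable fun u : HeightOneSpectrum (𝓞 F) =>
              ((P u).eval ((u.residueCard : ℂ) ^ (-s)))⁻¹) ∧
            (∀ u, (P u).eval ((u.residueCard : ℂ) ^ (-s)) ≠ 0) ∧
            Λ s * Γ s =
              ∏' u : HeightOneSpectrum (𝓞 F), ((P u).eval ((u.residueCard : ℂ) ^ (-s)))⁻¹) ∧
        (∀ s : ℂ, c < s.re →
          (Multipliable fun u : HeightOneSpectrum (𝓞 F) =>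
              ((P' u).eval ((u.residueCard : ℂ) ^ (-s)))⁻¹) ∧
            (∀ u, (P' u).eval ((u.residueCard : ℂ) ^ (-s)) ≠ 0) ∧
            Λ' s * Γ' s =
              ∏' u : HeightOneSpectrum (𝓞 F), ((P' u).eval ((u.residueCard : ℂ) ^ (-s)))⁻¹) ∧
        (∀ s, Λ s = ε s * Λ' (1 - s))) :
    frobSatakeCompatibleAt_of_isPiOfArtinRep_of_isUnramifiedAt :=
  frobSatakeCompatibleAt_of_isPiOfArtinRep_of_isUnramifiedAt_of_JacquetLanglands1970_standardLTheoryGL2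
    (JacquetLanglands1970_standardLTheoryGL2_of_globalHeckeTheory hR1)

end Literature.NumberTheory.Automorphic

end
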